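import Summits.Ventures.GridStability.Models.NE39SP
import Summits.Ventures.GridStability.Models.StructurePreservingLurieRoa
import Summits.Ventures.GridStability.Models.StructurePreservingGlobal
import Summits.Ventures.GridStability.Models.StructurePreservingLurieLevel

/-!
# GridStability/Models/NE39SPLurie — the NE39 structure-preserving instance «G2.b-SP NE39» as a
# Vu–Turitsyn bilinear system relative to bus 39: every certificate-independent hypothesis of the
# SP / Lur'e lane discharged (instance typing; NO certificate here)

LADDER-GRIDFUSION G2 «SP–Lur'e lane» / G3, seat gridfusion-model-2 (g5; instance TYPING per PARTITION
A25: data model-4 · typing model-2 · certificate producer sos-4 class · -roa sentence lyap-1).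
MODEL-VALIDITY row MV-3, instance tokens of `NE39SP` («MV-3 + lossless + MV-P + 60-Hz base (ω_s := 377
declared) + V-frozen(LF) + |E|′(h12)») with «D⟨declared by the certificate⟩» in place of «D(∀)»
(a quadratic certificate depends on the damping / load-frequency vector `D` — MODEL-VALIDITY v0.29)
and «ref bus 39 (bookkeeping; conclusions reference-free)».

WHAT IS HERE (all PROVED, 0 kit, data = the tree's `NE39SP` literals of record, sp49.json
fddec35dcf838149 via p480737):
* `ref = 38` (bus 39, a first-order network bus, `ref ∉ gen`), `gnode j = 39 + j` (machines
  G1…G10 ↦ internal nodes 39…48; injective, range = `genS` — two `decide`s);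
* `lyapunov_phaseField_params` — lyap-1's `phaseField (params D)` = `(params D).phaseField` (ω₀ = 0),
  so every statement below reads over either convention;
* `NE39SP.relLurie D` — THE OBJECT a producer certifies: `(params D).relLurie ref gnode srcV tgtV wt δ₀`,
  a `LyapunovFunctionFamily.System (Fin 48 ⊕ Fin 10) (Fin 56)` (58 states, 56 lines) whose `A, B, C`
  are rational in `(D, M = 2H/377, wt = VᵢVⱼ/x)` and whose `δ*_e = δ₀(src e) − δ₀(tgt e)` are
  differences of `2·arctan` of the typed half-angle tangents [cite: VuTuritsyn2017, §3 eq. (Bilinear)];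
* `relLurie_obs D` — the observability hypothesis of the lane's kernel theorem, for every `D`;
* `lineAngle_abs_le_theta`, `lineAngle_abs_lt` — every listed equilibrium line angle has
  `|δ*_e| ≤ θ = 2·arctan τ_max < π/2` (the window datum of p480737);
* `sectorGain_theta_gt` — a certified rational gain bound `259/500 < g⋆(θ)` (from `sin θ = 2τ/(1+τ²)`
  exactly, `arctan τ ≥ sin(arctan τ) = τ/√(1+τ²) > 0.2013`, `π < 3.141593`); hence `gain_lt` — EVERY rational
  `g ≤ 259/500` is a strict sector gain on all 56 lines [cite: VuTuritsyn2017, §4.2 Lemma 2];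
* `levelRadius = 1.570796 − 2τ_max`, `level_of_rational` — the level hypothesis from the RATIONAL test
  `c·s_e ≤ ρ²` (`|δ*_e| ≤ θ ≤ 2τ_max`, `π > 3.141592`);
* `lurie_roa` — **the lane's sentence for this instance MODULO THE CERTIFICATE**: for every damping
  vector `D > 0` and every exact quadratic certificate `Λ = (P, g, ε)` on `relLurie D` with
  `g ≤ 259/500`, rank-one level facts `s_e·P − C_eᵀC_e ⪰ 0` and `c < min_e (π/2 − |δ*_e|)²/s_e`:
  from every phase point whose 56 listed line angles lie in `(−π/2, π/2)` and whose relative state has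
  `V ≤ c` there IS a solution of MODEL M′ = `(params D).phaseField` (and only one), and EVERY solution
  keeps both conditions for all `t ≥ 0`, all 49·48 angle differences converge to the equilibrium's and
  all ten machine frequency deviations tend to `0`; `lurie_roa_of_rationalLevel` — the same from the
  rational level test; `lurie_roa_of_isSolution` — the same in the PRINTED second-order vocabulary
  (`(params D).IsSolution δ`, machine speeds `δ̇ᵥ → 0` since `ω₀ = 0`).
WHAT IS NOT HERE: any `(P, g, ε, s, c)` — that is the producer's SDP + exact rounding + kernel PSD
checks (58 × 58), for a DECLARED numeric `D` (Padiyar App. D prints no load-bus `Dᵢ`; MODEL-VALIDITY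
Q-MV-3); nothing here says the New England system is stable. THREE COLUMNS: CERTIFIED (given `Λ`) =
`lurie_roa` about MODEL M′; MODELLED = the tokens above; VALIDATED = any comparison with
[cite: VuTuritsyn2017, §5] or [cite: Padiyar2013, Table 4.1].
-/

noncomputable section

open Finset Real Set Filter Matrix
open scoped Topology
open Literature.MathematicalPhysics.PowerSystems
open Literature.MathematicalPhysics.PowerSystems.LyapunovFunctionFamily

namespace Summit.Ventures.GridStability.Models.NE39SP

open StructurePreserving StructurePreserving.Params

/-! ## Reference bus and generator enumeration -/

/-- The reference bus: bus 39 (node index `38`), a first-order network bus. -/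
def ref : Fin 49 := 38

/-- Bus 39 is not a generator internal node. -/
theorem ref_not_mem : ref ∉ genS := by decide

/-- Enumeration of the generator internal nodes: machine `Gⱼ₊₁ ↦ node 39 + j`. -/
def gnode (j : Fin 10) : Fin 49 := ⟨39 + j.val, by omega⟩

/-- The enumeration is injective. -/
theorem gnode_injective : Function.Injective gnode := by
  intro a b h
  have : (39 + a.val) = 39 + b.val := congrArg Fin.val h
  exact Fin.ext (by omega)

/-- The enumeration is onto `gen = {39, …, 48}`. -/
theorem mem_genS_iff : ∀ v : Fin 49, v ∈ genS ↔ ∃ j, gnode j = v := by decide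

/-- `params D` has the edge-list couplings of the typed lists (definitional). -/
theorem params_b_eq (D : Fin 49 → ℝ) : (params D).b = symmetrize (edgeWeight srcV tgtV wt) := rfl

/-- `P⁰ = f(δ₀)` nodewise (eq=b of record). -/
theorem pe_δ₀_eq_P0 (D : Fin 49 → ℝ) : ∀ v, (params D).pe δ₀ v = (params D).P0 v :=
  fun v => (congrFun (params_P0 D) v).symm

/-- The Lyapunov seat's phase field of `params D` (`Lyapunov.StructurePreserving.phaseField`, powers
shifted to `P̄`) IS model-2's `(params D).phaseField`: with `P⁰ := f(δ₀)` the shift is trivial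
(`ω₀ = 0`). So `lurie_roa` below reads verbatim over either convention. -/
theorem lyapunov_phaseField_params (D : Fin 49 → ℝ) :
    Lyapunov.StructurePreserving.phaseField (params D) = (params D).phaseField := by
  rw [lyapunov_phaseField_eq, (params D).shifted_eq_self_of_P0_eq_pe b_symm (params_P0 D)]

/-! ## The bilinear object of the lane -/

/-- **THE SP–Lur'e OBJECT of «G2.b-SP NE39»** for a damping / load-frequency vector `D`: the
structure-preserving model `params D` relative to bus 39, as lit-6's Vu–Turitsyn system on
`Fin 48 ⊕ Fin 10` states and `Fin 56` lines. MODELLED: MV-3 instance tokens + «D⟨declared⟩» + «ref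
bus 39». [cite: VuTuritsyn2017, §3 eq. (Bilinear)] -/
def relLurie (D : Fin 49 → ℝ) : LyapunovFunctionFamily.System (Fin 48 ⊕ Fin 10) (Fin 56) :=
  (params D).relLurie ref gnode srcV tgtV wt δ₀

/-- Unfolding lemma. -/
theorem relLurie_eq (D : Fin 49 → ℝ) :
    relLurie D = (params D).relLurie ref gnode srcV tgtV wt δ₀ := rfl

/-- **Observability** of the NE39-SP bilinear object, for every `D`: `Cx = 0 ∧ CAx = 0 ⇒ x = 0`
(connectivity of the 49-node coupling graph through bus 39). [cite: VuTuritsyn2017, Appendix 7.2] -/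
theorem relLurie_obs (D : Fin 49 → ℝ) (x : Fin 48 ⊕ Fin 10 → ℝ) (h1 : (relLurie D).C *ᵥ x = 0)
    (h2 : (relLurie D).C *ᵥ ((relLurie D).A *ᵥ x) = 0) : x = 0 :=
  Params.relLurie_obs ref_not_mem gnode_injective mem_genS_iff (params_b_eq D) (preconnected D) x h1 h2

/-! ## Equilibrium line angles and the gain -/

/-- Every listed edge is a coupled pair of `params D`. -/
theorem b_edge_ne_zero (D : Fin 49 → ℝ) (e : Fin 56) : (params D).b (srcV e) (tgtV e) ≠ 0 := by
  rw [params_b_eq]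
  exact symmetrize_edgeWeight_ne_zero_of_edge wt_nonneg e (wt_pos e) (Or.inl ⟨rfl, rfl⟩)

/-- **Equilibrium line angles are inside the window**: `|δ₀(src e) − δ₀(tgt e)| ≤ θ = 2·arctan τ_max`
for every listed edge. -/
theorem lineAngle_abs_le_theta (e : Fin 56) : |δ₀ (srcV e) - δ₀ (tgtV e)| ≤ θ :=
  window (fun _ => 1) (srcV e) (tgtV e) (b_edge_ne_zero _ e)

/-- `|δ*_e| < π/2` for every listed edge (hypothesis `hδs` of the lane's theorem). -/
theorem lineAngle_abs_lt (e : Fin 56) : |δ₀ (srcV e) - δ₀ (tgtV e)| < π / 2 :=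
  (lineAngle_abs_le_theta e).trans_lt theta_lt_pi_div_two

/-- **A certified rational strict-gain bound**: `259/500 < g⋆(θ) = (1 − sin θ)/(π/2 − θ)`
(`sin θ = 2τ/(1 + τ²)` exactly; `θ = 2·arctan τ ≥ 2·sin(arctan τ) = 2τ/√(1 + τ²) > 0.4026`;
`π/2 < 1.5707965`). [cite: VuTuritsyn2017, §4.1 eq. (gain)] -/
theorem sectorGain_theta_gt : (259 / 500 : ℝ) < sectorGain θ := by
  have hτ0 : (0 : ℝ) < (tauLF : ℝ) := by exact_mod_cast (show (0 : ℚ) < tauLF by norm_num [tauLF])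
  have hθ0 := theta_nonneg
  have hθ := theta_lt_pi_div_two
  -- sin θ exactly
  have hsin : Real.sin θ = 2 * (tauLF : ℝ) / (1 + (tauLF : ℝ) ^ 2) :=
    Lyapunov.StructurePreserving.sin_two_mul_arctan _
  -- θ > 0.4026 via arctan τ ≥ sin (arctan τ) = τ / √(1 + τ²)
  have hq : (2013 / 10000 : ℝ) < Real.arctan (tauLF : ℝ) := by
    have hat0 : 0 ≤ Real.arctan (tauLF : ℝ) := by
      have := Real.arctan_strictMono.monotone hτ0.le
      rwa [Real.arctan_zero] at this
    have h1 : Real.sin (Real.arctan (tauLF : ℝ)) ≤ Real.arctan (tauLF : ℝ) := Real.sin_le hat0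
    rw [Real.sin_arctan] at h1
    have hsq : Real.sqrt (1 + (tauLF : ℝ) ^ 2) < (tauLF : ℝ) / (2013 / 10000) := by
      rw [Real.sqrt_lt' (div_pos hτ0 (by norm_num))]
      have : (1 : ℚ) + tauLF ^ 2 < (tauLF / (2013 / 10000)) ^ 2 := by norm_num [tauLF]
      have h := (Rat.cast_lt (K := ℝ)).2 this
      push_cast at h
      exact h
    have hpos : 0 < Real.sqrt (1 + (tauLF : ℝ) ^ 2) := Real.sqrt_pos.2 (by positivity)
    have h2 : (2013 / 10000 : ℝ) < (tauLF : ℝ) / Real.sqrt (1 + (tauLF : ℝ) ^ 2) := by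
      rw [lt_div_iff₀ hpos]
      have := mul_lt_mul_of_pos_left hsq (show (0 : ℝ) < 2013 / 10000 by norm_num)
      calc (2013 / 10000 : ℝ) * Real.sqrt (1 + (tauLF : ℝ) ^ 2)
          < 2013 / 10000 * ((tauLF : ℝ) / (2013 / 10000)) := this
        _ = (tauLF : ℝ) := by field_simp
    exact h2.trans_le h1
  have hθq : (2013 / 5000 : ℝ) < θ := by unfold θ; linarith
  have hden : 0 < π / 2 - θ := by linarith
  have hdenU : π / 2 - θ < 1.5707965 - 2013 / 5000 := by linarith [Real.pi_lt_d6]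
  rw [sectorGain, abs_of_nonneg hθ0, lt_div_iff₀ hden, hsin]
  have hnum : (259 / 500 : ℝ) * (1.5707965 - 2013 / 5000)
      < 1 - 2 * (tauLF : ℝ) / (1 + (tauLF : ℝ) ^ 2) := by
    have : (259 / 500 : ℚ) * (1.5707965 - 2013 / 5000) < 1 - 2 * tauLF / (1 + tauLF ^ 2) := by
      norm_num [tauLF]
    have h := (Rat.cast_lt (K := ℝ)).2 this
    push_cast at h
    exact h
  nlinarith

/-- **Every rational gain `g ≤ 259/500` is a strict sector gain on all 56 lines**: `g < g⋆(δ*_e)`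
(`g⋆` antitone in `|δ*|`, `|δ*_e| ≤ θ`, `259/500 < g⋆(θ)`). [cite: VuTuritsyn2017, §4.2 Lemma 2] -/
theorem gain_lt {g : ℝ} (hg : g ≤ 259 / 500) (e : Fin 56) :
    g < sectorGain (δ₀ (srcV e) - δ₀ (tgtV e)) :=
  gain_lt_sectorGain_of_le (σs := fun e => δ₀ (srcV e) - δ₀ (tgtV e)) theta_nonneg
    theta_lt_pi_div_two lineAngle_abs_le_theta (hg.trans_lt sectorGain_theta_gt) e

/-! ## A rational level test -/

/-- `θ ≤ 2τ_max` (`arctan τ ≤ τ`). -/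
theorem theta_le_two_mul_tau : θ ≤ 2 * (tauLF : ℝ) := by
  have hτ0 : (0 : ℝ) ≤ (tauLF : ℝ) := by exact_mod_cast (show (0 : ℚ) ≤ tauLF by norm_num [tauLF])
  unfold θ
  linarith [Lyapunov.StructurePreserving.arctan_le_self hτ0]

/-- A rational radius below every `π/2 − |δ*_e|`: `ρ = 1.570796 − 2τ_max` (≈ 1.1596). -/
def levelRadius : ℚ := 1.570796 - 2 * tauLF

/-- `ρ < π/2 − |δ*_e|` for every listed line (`|δ*_e| ≤ θ ≤ 2τ`, `π > 3.141592`). -/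
theorem levelRadius_lt (e : Fin 56) :
    (levelRadius : ℝ) < π / 2 - |δ₀ (srcV e) - δ₀ (tgtV e)| := by
  have h1 := lineAngle_abs_le_theta e
  have h2 := theta_le_two_mul_tau
  have h3 := Real.pi_gt_d6
  have h4 : ((levelRadius : ℚ) : ℝ) = 1.570796 - 2 * (tauLF : ℝ) := by
    push_cast [levelRadius]; ring
  rw [h4]
  linarith

/-- **Rational level test**: rank-one constants `s_e > 0` and a level `c` with `c·s_e ≤ ρ²` for all
56 lines satisfy the level hypothesis `c < (π/2 − |δ*_e|)²/s_e` of the lane's theorem — a finite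
rational check for a producer's `(s, c)`. [cite: VuTuritsyn2017, §4.3 eq. (V_min)] -/
theorem level_of_rational {s : Fin 56 → ℝ} (hs0 : ∀ e, 0 < s e) {c : ℝ}
    (hc : ∀ e, c * s e ≤ (levelRadius : ℝ) ^ 2) (e : Fin 56) :
    c < (π / 2 - |δ₀ (srcV e) - δ₀ (tgtV e)|) ^ 2 / s e := by
  rw [lt_div_iff₀ (hs0 e)]
  have hρ0 : (0 : ℝ) ≤ (levelRadius : ℝ) := by
    exact_mod_cast (show (0 : ℚ) ≤ levelRadius by norm_num [levelRadius, tauLF])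
  have hlt := levelRadius_lt e
  have hsq : (levelRadius : ℝ) ^ 2 < (π / 2 - |δ₀ (srcV e) - δ₀ (tgtV e)|) ^ 2 :=
    pow_lt_pow_left₀ hlt hρ0 two_ne_zero
  exact (hc e).trans_lt hsq

/-! ## The lane's sentence for this instance, modulo the certificate -/

/-- **SP–Lur'e sentence for «G2.b-SP NE39», MODULO THE CERTIFICATE.** For every damping /
load-frequency vector `D > 0` (DECLARED by whoever produces the certificate) and every exact quadratic
certificate `Λ = (P, g, ε)` for `relLurie D` [cite: VuTuritsyn2017, §4.2 Lemma 1] with gain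
`g ≤ 259/500`, rank-one level facts `s_e·P − C_eᵀC_e ⪰ 0`, `s_e > 0`, and a level
`c < (π/2 − |δ*_e|)²/s_e` for all 56 lines: from every phase point `y = (δ, ω)` whose listed line
angles lie in `(−π/2, π/2)` and with `V(relState y) = relState(y)ᵀ P relState(y) ≤ c`, (a) a
solution of MODEL M′ = `(params D).phaseField` exists (and is unique, `phaseSolution_unique`), and
(b) EVERY solution from `y` keeps the 56 line angles in `(−π/2, π/2)` and `V ≤ c` for all `t ≥ 0`,
every bus-angle difference `δ_v(t) − δ_w(t) → δ₀_v − δ₀_w`, and every machine frequency deviation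
`ω_v(t) → 0` (`v ∈ gen`). CERTIFIED given `Λ`; MODELLED: MV-3 + lossless + MV-P + D⟨declared⟩ +
60-Hz base (ω_s := 377) + V-frozen(LF) + |E|′(h12) + ref bus 39; inner estimate; nothing here says
the New England system is stable. [cite: VuTuritsyn2017, §4.3 Theorem 1] -/
theorem lurie_roa {D : Fin 49 → ℝ} (hD : ∀ i, 0 < D i) (Λ : QuadraticCertificate (relLurie D))
    (hg : Λ.g ≤ 259 / 500) {s : Fin 56 → ℝ} (hs0 : ∀ e, 0 < s e)
    (hs : ∀ e, (s e • Λ.P - Matrix.vecMulVec ((relLurie D).C e) ((relLurie D).C e)).PosSemidef)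
    {c : ℝ} (hcs : ∀ e, c < (π / 2 - |δ₀ (srcV e) - δ₀ (tgtV e)|) ^ 2 / s e)
    {y : (Fin 49 → ℝ) × (Fin 49 → ℝ)} (hy : ∀ e, |y.1 (srcV e) - y.1 (tgtV e)| < π / 2)
    (hyc : Λ.V (relState ref gnode δ₀ y) ≤ c) :
    (∃ X : ℝ → (Fin 49 → ℝ) × (Fin 49 → ℝ), X 0 = y ∧
        ∀ T : ℝ, ∀ t ∈ Icc 0 T, HasDerivWithinAt X ((params D).phaseField (X t)) (Icc 0 T) t) ∧
      ∀ X : ℝ → (Fin 49 → ℝ) × (Fin 49 → ℝ), X 0 = y →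
        (∀ T : ℝ, ∀ t ∈ Icc 0 T, HasDerivWithinAt X ((params D).phaseField (X t)) (Icc 0 T) t) →
        (∀ t, 0 ≤ t → (∀ e, |(X t).1 (srcV e) - (X t).1 (tgtV e)| < π / 2) ∧
            Λ.V (relState ref gnode δ₀ (X t)) ≤ c) ∧
          (∀ v w, Tendsto (fun t => (X t).1 v - (X t).1 w) atTop (𝓝 (δ₀ v - δ₀ w))) ∧
          ∀ v ∈ genS, Tendsto (fun t => (X t).2 v) atTop (𝓝 0) := by
  refine ⟨(params D).exists_phaseSolution_Icc y, fun X hX0 hX => ?_⟩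
  subst hX0
  obtain ⟨hstay, hlim⟩ := tendsto_relState_of_quadraticCertificate_of_rankOne (wellFormed hD)
    ref_not_mem gnode_injective mem_genS_iff (params_b_eq D) (preconnected D) (pe_δ₀_eq_P0 D) Λ
    lineAngle_abs_lt (gain_lt hg) hs0 hs hcs hX hy hyc
  exact ⟨hstay, tendsto_of_tendsto_relState (p := params D) mem_genS_iff hlim⟩

/-- **The same sentence from the RATIONAL level test** `c·s_e ≤ ρ²`, `ρ = 1.570796 − 2τ_max`
(`level_of_rational`): every hypothesis left is a statement about the producer's exact rationals
`(P, ε, g, s, c)` and the declared `D`. [cite: VuTuritsyn2017, §4.3 Theorem 1 with eq. (V_min)] -/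
theorem lurie_roa_of_rationalLevel {D : Fin 49 → ℝ} (hD : ∀ i, 0 < D i)
    (Λ : QuadraticCertificate (relLurie D)) (hg : Λ.g ≤ 259 / 500) {s : Fin 56 → ℝ}
    (hs0 : ∀ e, 0 < s e)
    (hs : ∀ e, (s e • Λ.P - Matrix.vecMulVec ((relLurie D).C e) ((relLurie D).C e)).PosSemidef)
    {c : ℝ} (hc : ∀ e, c * s e ≤ (levelRadius : ℝ) ^ 2)
    {y : (Fin 49 → ℝ) × (Fin 49 → ℝ)} (hy : ∀ e, |y.1 (srcV e) - y.1 (tgtV e)| < π / 2)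
    (hyc : Λ.V (relState ref gnode δ₀ y) ≤ c) :
    (∃ X : ℝ → (Fin 49 → ℝ) × (Fin 49 → ℝ), X 0 = y ∧
        ∀ T : ℝ, ∀ t ∈ Icc 0 T, HasDerivWithinAt X ((params D).phaseField (X t)) (Icc 0 T) t) ∧
      ∀ X : ℝ → (Fin 49 → ℝ) × (Fin 49 → ℝ), X 0 = y →
        (∀ T : ℝ, ∀ t ∈ Icc 0 T, HasDerivWithinAt X ((params D).phaseField (X t)) (Icc 0 T) t) →
        (∀ t, 0 ≤ t → (∀ e, |(X t).1 (srcV e) - (X t).1 (tgtV e)| < π / 2) ∧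
            Λ.V (relState ref gnode δ₀ (X t)) ≤ c) ∧
          (∀ v w, Tendsto (fun t => (X t).1 v - (X t).1 w) atTop (𝓝 (δ₀ v - δ₀ w))) ∧
          ∀ v ∈ genS, Tendsto (fun t => (X t).2 v) atTop (𝓝 0) :=
  lurie_roa hD Λ hg hs0 hs (level_of_rational hs0 hc) hy hyc

/-- **The same sentence in the PRINTED second-order vocabulary** (`(params D).IsSolution δ`:
`Mᵥδ̈ᵥ + Dᵥδ̇ᵥ + fᵥ(δ) = P⁰ᵥ` at all 49 nodes; here `ω₀ = 0` since `P⁰ := f(δ₀)`): for every such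
solution whose initial listed line angles lie in `(−π/2, π/2)` and whose initial relative state
`relState(δ(0), δ̇(0))` has `V ≤ c` (rational level test `c·s_e ≤ ρ²`): the 56 line angles stay in
`(−π/2, π/2)`, every angle difference `δᵥ(t) − δ_w(t) → δ₀ᵥ − δ₀_w`, every machine speed deviation
`δ̇ᵥ(t) → 0`. MODELLED as `lurie_roa`. [cite: VuTuritsyn2017, §4.3 Theorem 1]; [cite: Padiyar2013, §3.2 eq (3.2)] -/
theorem lurie_roa_of_isSolution {D : Fin 49 → ℝ} (hD : ∀ i, 0 < D i)
    (Λ : QuadraticCertificate (relLurie D)) (hg : Λ.g ≤ 259 / 500) {s : Fin 56 → ℝ}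
    (hs0 : ∀ e, 0 < s e)
    (hs : ∀ e, (s e • Λ.P - Matrix.vecMulVec ((relLurie D).C e) ((relLurie D).C e)).PosSemidef)
    {c : ℝ} (hc : ∀ e, c * s e ≤ (levelRadius : ℝ) ^ 2)
    {δ : ℝ → Fin 49 → ℝ} (hδ : (params D).IsSolution δ)
    (h0 : ∀ e, |δ 0 (srcV e) - δ 0 (tgtV e)| < π / 2)
    (hVc : Λ.V (relState ref gnode δ₀ (δ 0, fun v => deriv (fun u => δ u v) 0)) ≤ c) :
    (∀ t, 0 ≤ t → ∀ e, |δ t (srcV e) - δ t (tgtV e)| < π / 2) ∧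
      (∀ v w, Tendsto (fun t => δ t v - δ t w) atTop (𝓝 (δ₀ v - δ₀ w))) ∧
      ∀ v ∈ genS, Tendsto (fun t => deriv (fun u => δ u v) t) atTop (𝓝 0) := by
  have hsf : (params D).syncFreq = 0 := syncFreq_eq_zero D
  have hVc' : Λ.V (relState ref gnode δ₀
      (δ 0, fun v => deriv (fun u => δ u v) 0 - (params D).syncFreq)) ≤ c := by
    simpa only [hsf, sub_zero] using hVc
  have h := tendsto_of_isSolution_of_quadraticCertificate (p := params D) (wellFormed hD)
    ref_not_mem gnode_injective mem_genS_iff (params_b_eq D) (preconnected D) (isSyncEquilibrium D)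
    Λ lineAngle_abs_lt (gain_lt hg)
    (fun _ hx => Λ.lt_V_of_mem_frontier_halfPolytope lineAngle_abs_lt hs0 hs
      (level_of_rational hs0 hc) hx) hδ h0 hVc'
  rw [hsf] at h
  exact h

/-! ## The sentence with the `ε`-level: NO rank-one facts (model-2 g6)

With `StructurePreservingLurieLevel.lean` (`Params.relLurie_rankOne_of_eps`: every output row of the
relative object has `C_eᵀC_e ≤ 2`, so `(2/ε)·P − C_eᵀC_e ⪰ 0` follows from the certificate's own
`P − ε·1 ⪰ 0`), the producer's kernel obligations for «G2.b-SP NE39» shrink to the TWO matrix facts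
of `QuadraticCertificate` plus rational comparisons (`g ≤ 259/500`, `2c ≤ ε·ρ²`); the 56 rank-one
facts of `lurie_roa_of_rationalLevel` remain available for a sharper level. -/

/-- **Rational `ε`-level test**: `2c ≤ ε·ρ²` (`ρ = levelRadius = 1.570796 − 2τ_max`) puts `c`
strictly below `ε·(π/2 − |δ*_e|)²/2` on every listed line. [cite: VuTuritsyn2017, §4.3 eq. (V_min)] -/
theorem epsLevel_lt {D : Fin 49 → ℝ} (Λ : QuadraticCertificate (relLurie D)) {c : ℝ}
    (hc : 2 * c ≤ Λ.ε * (levelRadius : ℝ) ^ 2) (e : Fin 56) :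
    2 * c < Λ.ε * (π / 2 - |δ₀ (srcV e) - δ₀ (tgtV e)|) ^ 2 := by
  have hρ0 : (0 : ℝ) ≤ (levelRadius : ℝ) := by
    exact_mod_cast (show (0 : ℚ) ≤ levelRadius by norm_num [levelRadius, tauLF])
  have hsq : (levelRadius : ℝ) ^ 2 < (π / 2 - |δ₀ (srcV e) - δ₀ (tgtV e)|) ^ 2 :=
    pow_lt_pow_left₀ (levelRadius_lt e) hρ0 two_ne_zero
  have h := mul_lt_mul_of_pos_left hsq Λ.ε_pos
  linarith

/-- The `ε`-level passes the rational level test of `lurie_roa_of_rationalLevel` with the uniform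
rank-one constants `s_e := 2/ε`. -/
theorem epsLevel_rational {D : Fin 49 → ℝ} (Λ : QuadraticCertificate (relLurie D)) {c : ℝ}
    (hc : 2 * c ≤ Λ.ε * (levelRadius : ℝ) ^ 2) (_e : Fin 56) :
    c * (2 / Λ.ε) ≤ (levelRadius : ℝ) ^ 2 := by
  have hε := Λ.ε_pos
  rw [mul_div_assoc', div_le_iff₀ hε]
  linarith

/-- **SP–Lur'e sentence for «G2.b-SP NE39» with the `ε`-LEVEL — the producer supplies ONLY
`Λ = (P, g, ε)`.** For every DECLARED damping / load-frequency vector `D > 0` and every exact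
quadratic certificate `Λ` for `relLurie D` [cite: VuTuritsyn2017, §4.2 Lemma 1] with `g ≤ 259/500`
and a level `c` with `2c ≤ ε·ρ²` (`ρ = 1.570796 − 2τ_max`, rational test): from every phase point
whose 56 listed line angles lie in `(−π/2, π/2)` and whose relative state has `V ≤ c`, a solution of
MODEL M′ = `(params D).phaseField` exists (unique by `phaseSolution_unique`) and EVERY solution keeps
both conditions for all `t ≥ 0`, every bus-angle difference tends to the equilibrium's and every
machine frequency deviation tends to `0`. Kernel obligations left to a producer: the two
positive-semidefiniteness fields of `Λ` (58 × 58) and two rational inequalities — no per-line fact.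
CERTIFIED given `Λ`; MODELLED: MV-3 + lossless + MV-P + D⟨declared⟩ + 60-Hz base (ω_s := 377) +
V-frozen(LF) + |E|′(h12) + ref bus 39; inner estimate (the `_of_rationalLevel` route with Schur-optimal
`s_e` gives a larger level); nothing here says the New England system is stable.
[cite: VuTuritsyn2017, §4.3 Theorem 1 with eq. (V_min)] -/
theorem lurie_roa_of_eps {D : Fin 49 → ℝ} (hD : ∀ i, 0 < D i)
    (Λ : QuadraticCertificate (relLurie D)) (hg : Λ.g ≤ 259 / 500)
    {c : ℝ} (hc : 2 * c ≤ Λ.ε * (levelRadius : ℝ) ^ 2)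
    {y : (Fin 49 → ℝ) × (Fin 49 → ℝ)} (hy : ∀ e, |y.1 (srcV e) - y.1 (tgtV e)| < π / 2)
    (hyc : Λ.V (relState ref gnode δ₀ y) ≤ c) :
    (∃ X : ℝ → (Fin 49 → ℝ) × (Fin 49 → ℝ), X 0 = y ∧
        ∀ T : ℝ, ∀ t ∈ Icc 0 T, HasDerivWithinAt X ((params D).phaseField (X t)) (Icc 0 T) t) ∧
      ∀ X : ℝ → (Fin 49 → ℝ) × (Fin 49 → ℝ), X 0 = y →
        (∀ T : ℝ, ∀ t ∈ Icc 0 T, HasDerivWithinAt X ((params D).phaseField (X t)) (Icc 0 T) t) →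
        (∀ t, 0 ≤ t → (∀ e, |(X t).1 (srcV e) - (X t).1 (tgtV e)| < π / 2) ∧
            Λ.V (relState ref gnode δ₀ (X t)) ≤ c) ∧
          (∀ v w, Tendsto (fun t => (X t).1 v - (X t).1 w) atTop (𝓝 (δ₀ v - δ₀ w))) ∧
          ∀ v ∈ genS, Tendsto (fun t => (X t).2 v) atTop (𝓝 0) :=
  lurie_roa_of_rationalLevel hD Λ hg (s := fun _ => 2 / Λ.ε) (fun _ => div_pos two_pos Λ.ε_pos)
    (fun e => relLurie_rankOne_of_eps (params D) ref gnode srcV tgtV wt δ₀ Λ e)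
    (epsLevel_rational Λ hc) hy hyc

/-- **The `ε`-level sentence in the PRINTED second-order vocabulary** (`(params D).IsSolution δ`:
`Mᵥδ̈ᵥ + Dᵥδ̇ᵥ + fᵥ(δ) = P⁰ᵥ` at all 49 nodes; `ω₀ = 0`): for every such solution whose initial listed
line angles lie in `(−π/2, π/2)` and whose initial relative state has `V ≤ c`, `2c ≤ ε·ρ²`: the 56
line angles stay in `(−π/2, π/2)`, every angle difference `δᵥ(t) − δ_w(t) → δ₀ᵥ − δ₀_w`, every
machine speed deviation `δ̇ᵥ(t) → 0`. MODELLED as `lurie_roa_of_eps`.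
[cite: VuTuritsyn2017, §4.3 Theorem 1]; [cite: Padiyar2013, §3.2 eq (3.2)] -/
theorem lurie_roa_of_eps_of_isSolution {D : Fin 49 → ℝ} (hD : ∀ i, 0 < D i)
    (Λ : QuadraticCertificate (relLurie D)) (hg : Λ.g ≤ 259 / 500)
    {c : ℝ} (hc : 2 * c ≤ Λ.ε * (levelRadius : ℝ) ^ 2)
    {δ : ℝ → Fin 49 → ℝ} (hδ : (params D).IsSolution δ)
    (h0 : ∀ e, |δ 0 (srcV e) - δ 0 (tgtV e)| < π / 2)
    (hVc : Λ.V (relState ref gnode δ₀ (δ 0, fun v => deriv (fun u => δ u v) 0)) ≤ c) :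
    (∀ t, 0 ≤ t → ∀ e, |δ t (srcV e) - δ t (tgtV e)| < π / 2) ∧
      (∀ v w, Tendsto (fun t => δ t v - δ t w) atTop (𝓝 (δ₀ v - δ₀ w))) ∧
      ∀ v ∈ genS, Tendsto (fun t => deriv (fun u => δ u v) t) atTop (𝓝 0) := by
  have hsf : (params D).syncFreq = 0 := syncFreq_eq_zero D
  have hVc' : Λ.V (relState ref gnode δ₀
      (δ 0, fun v => deriv (fun u => δ u v) 0 - (params D).syncFreq)) ≤ c := by
    simpa only [hsf, sub_zero] using hVc
  have h := tendsto_of_isSolution_of_quadraticCertificate (p := params D) (wellFormed hD)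
    ref_not_mem gnode_injective mem_genS_iff (params_b_eq D) (preconnected D) (isSyncEquilibrium D)
    Λ lineAngle_abs_lt (gain_lt hg)
    (relLurie_lt_V_frontier_of_eps Λ lineAngle_abs_lt (epsLevel_lt Λ hc)) hδ h0 hVc'
  rw [hsf] at h
  exact h

end Summit.Ventures.GridStability.Models.NE39SP

end
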